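import Summits.Parity.GeneralizedHardyLittlewood.Theorems.LeeYangFibresPrimeCellsRelativeGoldbach
import Summits.Parity.GeneralizedHardyLittlewood.Theorems.LeeYangFibresPrimeCellsRelativeChowlaDefs
import HarnessLib

/-!
# The pair slice of the crux implies Hardy–Littlewood's Conjecture A
# (crux stmt-Parity-14112, route `LeeYangFibres`, line `SketchIdeator4`)

The hardness certificate `Sketch.primeCellsRelative_implies_hardyLittlewoodGoldbach`
(`Theorems/LeeYangFibresPrimeCellsRelativeGoldbach.lean`) uses the crux `PrimeCellsRelative` of route
`LeeYangFibres` (Parity / GeneralizedHardyLittlewood) only at `t = 2` forms (and size bound `L = 3`), so it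
localises to the PAIR slice `PrimeCellsRelativeAt 2`
(`Theorems/LeeYangFibresPrimeCellsRelativeChowlaDefs.lean`):

* `hardyLittlewoodGoldbach_of_primeCellsRelativeAt_two` (registered stub of stmt-Parity-14112, line
  `SketchIdeator4`) — `PrimeCellsRelativeAt 2` implies the Hardy–Littlewood Goldbach asymptotic
  `R(N) ∼ 𝔖(N) N / log² N` through the even integers (parity.S35,
  `Literature.NumberTheory.Sieve.HardyLittlewoodGoldbach`): the proof of the `Sketch` certificate verbatim,
  the crux being applied at `t = 2`, `L = 3` only (the Goldbach systems `(n, N - n)` have `‖·‖_N ≤ 3`, so one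
  threshold of the slice serves every even `N`; `∏_p β_p = 𝔖(N) ≥ 2C₂ > 0`, `β_∞([0, N]) = N`, prime-point
  count `= R(N)`, prime number theorem window and `hl_arith` at `k = 2`);
* `eventual_goldbach_of_primeCellsRelativeAt_two` — hence binary Goldbach for all large even `N`
  (`HardyLittlewoodGoldbach.exists_forall_exists_prime_add_eq`, tree).

`PrimeCellsRelativeAt 2` and `HardyLittlewoodGoldbach` are conjecture-grade and appear only as hypothesis /
conclusion of implications; nothing is asserted about them.

References: G. H. Hardy, J. E. Littlewood, Acta Math. 44 (1923), §4.1 Conjecture A (4.11)–(4.12) p. 32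
[HardyLittlewoodPN3]; B. Green, T. Tao, Ann. of Math. 171 (2010), Conj. 1.4, Example 2 [GreenTao2010].
-/

noncomputable section

namespace Summit.Parity.GeneralizedHardyLittlewood.Cruxes.PrimeCellsRelative.SieveOutToChowla

open scoped BigOperators Topology Classical
open Filter Finset Asymptotics MeasureTheory Literature.NumberTheory.Sieve
open Summit.Parity.GeneralizedHardyLittlewood.Theses.LeeYangFibres
open Summit.Parity.GeneralizedHardyLittlewood.Theorems.LeeYangFibresCells
open Summit.Parity.GeneralizedHardyLittlewood.Theorems.PairsToGHL.Negative
open Summit.Parity.GeneralizedHardyLittlewood.Cruxes.PrimeCellsRelative.Sketch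

/-! ### Hardy–Littlewood's Conjecture A from the pair slice of the crux -/

/-- **The pair slice of the crux implies Hardy–Littlewood's Conjecture A** (parity.S35, the binary Goldbach
asymptotic `R(N) ∼ 𝔖(N) N/log² N` through the even integers, registered open in the tree; it contains binary
Goldbach for all large even `N`).  The proof of `Sketch.primeCellsRelative_implies_hardyLittlewoodGoldbach`
verbatim, the crux being used at `t = 2` forms and size bound `L = 3` only: the systems `(n, N - n)` change
with `N` but have `‖·‖_N ≤ 3`, so ONE threshold of the slice serves every even `N`; the dictionary of the
`Sketch` file gives `∏_p β_p = 𝔖(N) ≥ 2C₂ > 0`, `β_∞([0, N]) = N` and prime-point count `= R(N)`; the rest is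
the prime number theorem window and `hl_arith` at `k = 2`.  Registered stub of crux stmt-Parity-14112 (line
`SketchIdeator4`); the hypothesis is conjecture-grade and is not asserted.
[cite: HardyLittlewoodPN3, §4.1 Conjecture A (4.11)–(4.12) p. 32; GreenTao2010, Conj. 1.4] -/
theorem hardyLittlewoodGoldbach_of_primeCellsRelativeAt_two : PrimeCellsRelativeAt 2 → Literature.NumberTheory.Sieve.HardyLittlewoodGoldbach := by
  intro hP
  rw [HardyLittlewoodGoldbach, Asymptotics.IsEquivalent, Asymptotics.isLittleO_iff]
  intro δ₀ hδ₀
  rw [Filter.eventually_inf_principal]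
  -- work at precision `δ = min δ₀ 1`
  set δ : ℝ := min δ₀ 1 with hδdef
  have hδ : 0 < δ := lt_min hδ₀ one_pos
  have hδ1 : δ ≤ 1 := min_le_right _ _
  have hδδ₀ : δ ≤ δ₀ := min_le_left _ _
  have hC₂ : 0 < twinPrimeConst := twinPrimeConst_pos_holds
  set s₀ : ℝ := 2 * twinPrimeConst with hs₀def
  have hs₀ : 0 < s₀ := by positivity
  obtain ⟨η, hη0, hη12, hηup, hηlo⟩ := exists_eta_pow_near_one 2 (by positivity : 0 < δ / 8)
  set ε : ℝ := min (1 / 2) (δ / 8 * s₀ / (2 * s₀ + 1)) with hεdef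
  have hε0 : 0 < ε := lt_min (by norm_num) (by positivity)
  have hε' : ε ≤ δ / 8 * s₀ / (2 * s₀ + 1) := min_le_right _ _
  set c : ℝ := δ * s₀ / 48 with hcdef
  have hc : 0 < c := by positivity
  obtain ⟨u, hu, N₀, hN₀⟩ := hP 3 ε hε0
  have hwin := eventually_primeCounting_window hη0
  have hgrow := eventually_log_growth 2 1 hη0 hc hc
  filter_upwards [hwin, hgrow, eventually_ge_atTop N₀, eventually_ge_atTop 1] with N hNwin hNgr
    hNN₀ hN1 hNeven
  have hNeven' : Even N := hNeven
  obtain ⟨hlog1, -, -, hlogk⟩ := hNgr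
  have hN0 : N ≠ 0 := by omega
  have hN1' : (1 : ℝ) ≤ N := by exact_mod_cast hN1
  have hN0' : (0 : ℝ) < N := by linarith
  have hlog : 0 < Real.log N := by linarith
  have hss₀ : s₀ ≤ goldbachSingularSeries N :=
    two_mul_twinPrimeConst_le_goldbachSingularSeries hNeven'
  have hs : 0 < goldbachSingularSeries N := lt_of_lt_of_le hs₀ hss₀
  -- the Goldbach system and its dictionary
  have hnd : IsNondegenerateSystem (goldbachSystem (N : ℤ)) :=
    isNondegenerateSystem_goldbachSystem (by exact_mod_cast hN0)
  have haff := affLinSize_goldbachSystem_le hN1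
  have hsing := singularProduct_goldbachSystem hNeven' hN0
  have hcount := goldbachCount_eq_primePointCount N
  have hβ := archFactor_goldbachSystem N
  set K : Set (Fin 1 → ℝ) := Set.Icc (fun _ : Fin 1 => (0 : ℝ)) (fun _ => (N : ℝ)) with hK
  have hKc : Convex ℝ K := convex_Icc _ _
  have hKB : K ⊆ realBox 1 N := by
    refine Set.Icc_subset_Icc (fun _ => ?_) le_rfl
    show -(N : ℝ) ≤ 0
    linarith
  have hb := hN₀ N hNN₀ (goldbachSystem (N : ℤ)) hnd haff K hKc hKB
  rw [hsing] at hb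
  have hZ0 : 0 ≤ (N : ℝ) ^ ((1 : ℝ) / u) := Real.rpow_nonneg (Nat.cast_nonneg N) _
  -- assemble
  rw [Pi.sub_apply, Real.norm_eq_abs, Real.norm_eq_abs, hcount]
  refine le_trans ?_ (mul_le_mul_of_nonneg_right hδδ₀ (abs_nonneg _))
  refine hl_arith 2 hb (card_cells_le_primePointCount N _ (goldbachSystem (N : ℤ)) K)
    (primePointCount_le_card_cells_add hZ0 (goldbachSystem (N : ℤ)) hnd K) hN0' hlog hs hδ hδ1
    hε0.le ?_ ?_ ?_ (le_of_eq hβ) ?_ ?_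
  · -- `ε (2𝔖 + 1) ≤ (δ/8) 𝔖` from `ε ≤ (δ/8) s₀/(2 s₀ + 1)` and `s₀ ≤ 𝔖`
    calc ε * (2 * goldbachSingularSeries N + 1)
        ≤ δ / 8 * s₀ / (2 * s₀ + 1) * (2 * goldbachSingularSeries N + 1) :=
          mul_le_mul_of_nonneg_right hε' (by linarith)
      _ ≤ δ / 8 * goldbachSingularSeries N := by
          rw [div_mul_eq_mul_div, div_le_iff₀ (by positivity)]
          nlinarith [mul_nonneg hδ.le (sub_nonneg.mpr hss₀)]
  · -- the error count
    have h := errCount_mul_log_pow_le (k := 2) hN1' hu hlog1 hlogk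
    have h3 : 3 * ((2 : ℕ) : ℝ) * c * N = δ / 8 * (s₀ * N) := by rw [hcdef]; push_cast; ring
    rw [h3] at h
    refine h.trans ?_
    have := mul_le_mul_of_nonneg_right hss₀ hN0'.le
    nlinarith
  · rw [hβ]; nlinarith
  · refine hηlo.trans (pow_le_pow_left₀ (by linarith) ?_ _)
    exact (roughDensity_window hNwin hN1 hu).1
  · refine le_trans (pow_le_pow_left₀ ?_ ?_ _) hηup
    · exact mul_nonneg (div_nonneg (Nat.cast_nonneg _) (Nat.cast_nonneg _)) hlog.le
    · exact (roughDensity_window hNwin hN1 hu).2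

/-! ### Corollary: binary Goldbach for all large even `N` -/

/-- The pair slice of the crux gives binary Goldbach for all large even `N` (Hardy–Littlewood's "every
large even number is the sum of two odd primes", via the tree's
`HardyLittlewoodGoldbach.exists_forall_exists_prime_add_eq`); the hypothesis is conjecture-grade and is
not asserted. [cite: HardyLittlewoodPN3, §4.1 Conjecture A (4.11)–(4.12) p. 32; GreenTao2010, Conj. 1.4] -/
theorem eventual_goldbach_of_primeCellsRelativeAt_two (hP : PrimeCellsRelativeAt 2) :
    ∃ N₀ : ℕ, ∀ N : ℕ, N₀ ≤ N → Even N → ∃ p q : ℕ, p.Prime ∧ q.Prime ∧ p + q = N :=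
  (hardyLittlewoodGoldbach_of_primeCellsRelativeAt_two hP).exists_forall_exists_prime_add_eq

end Summit.Parity.GeneralizedHardyLittlewood.Cruxes.PrimeCellsRelative.SieveOutToChowla

end
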